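import Literature.RingTheory.CompleteLocalRings.CoefficientFieldSquareZero
import Mathlib.RingTheory.Smooth.Basic
import Mathlib.Algebra.Algebra.ZMod
import Mathlib.Algebra.CharP.Algebra
import HarnessLib

/-!
# Every field of characteristic `p` is formally smooth over the prime field (Matsumura, Thm. 26.9)

Topic: `Literature/FieldTheory/Separability`. Matsumura (*Commutative Ring Theory*, Thm. 26.9)
proves that a field extension `K/k` is `0`-smooth (= formally smooth) if and only if it is
separable. Over a PERFECT ground field every extension is separable (loc. cit., p. 204: "an
absolute `p`-basis of `k` is also a `p`-basis of `k/k₀`" for `k₀` perfect), so in particular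
every field is `0`-smooth over its prime field. This file proves the positive-characteristic
half of that statement:

* `formallySmooth_zmod` — **every field `K` of characteristic `p > 0` is formally smooth over
  `ZMod p`** (`Algebra.FormallySmooth (ZMod p) K`), with NO finiteness hypothesis on `K`;
  `formallySmooth_zmod_of_charP` is the same for the canonical `ZMod p`-algebra structure.

The characteristic-`0` half — every field of characteristic `0` is formally smooth over `ℚ` —
is `Literature.RingTheory.CompleteLocalRings.formallySmooth_rat`
(`Literature/RingTheory/CompleteLocalRings/CoefficientFieldSquareZero.lean`). Mathlib has the
statement only for extensions essentially of finite type over a perfect field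
(`Algebra.FormallySmooth.of_perfectField`, via separating transcendence bases).

## Proof

By Mathlib's `Algebra.FormallySmooth.of_split` it suffices that the surjection
`𝔽_p[X_y : y ∈ K] → K` splits modulo the square of its kernel `J`. The quotient
`B = 𝔽_p[X_y]/J²` has characteristic `p` and `J/J²` is a maximal ideal of square zero, so
Cohen's coefficient-field theorem in the square-zero case
(`Literature.RingTheory.CompleteLocalRings.exists_ringHom_section_of_sq_eq_bot_of_charP`,
Matsumura Thm. 28.3 (ii); its proof is the Frobenius-twist-and-`p`-th-roots argument of
Matsumura's Thms. 26.7–26.9) gives a ring section `B/(J/J²) → B`, which we transport along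
`B/(J/J²) ≅ K` and upgrade to a `ZMod p`-algebra map (ring maps out of `ZMod p` are unique).

## References

* H. Matsumura, *Commutative Ring Theory*, Cambridge Stud. Adv. Math. 8, CUP 1986: §25
  (`0`-smoothness, p. 193), Thm. 26.9 (p. 205 = PDF p. 222 of the held copy) with the remark on
  perfect subfields p. 204 (= PDF p. 221), Thm. 28.3 (ii). [Matsumura1987]
* A. Grothendieck, EGA 0_IV 19.6.1 (separable ⟺ formally smooth for field extensions).
-/

noncomputable section

namespace Literature.FieldTheory.Separability

universe u

/-- **Every field of characteristic `p` is formally smooth over the prime field `𝔽_p`**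
(Matsumura, Thm. 26.9: a field extension is `0`-smooth iff separable — and every extension of
the perfect field `𝔽_p` is separable, p. 204). Proof: the surjection `𝔽_p[X_y : y ∈ K] → K`
splits modulo the square of its kernel by Cohen's coefficient field of the square-zero
thickening (`Literature.RingTheory.CompleteLocalRings.exists_ringHom_section_of_sq_eq_bot_of_
charP`), so Mathlib's `Algebra.FormallySmooth.of_split` applies. No finiteness hypothesis on `K`.
[cite: Matsumura1987, Thm. 26.9 (case of the prime field)] -/
theorem formallySmooth_zmod (K : Type u) [Field K] (p : ℕ) [Fact p.Prime] [Algebra (ZMod p) K] :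
    Algebra.FormallySmooth (ZMod p) K := by
  classical
  let P := MvPolynomial K (ZMod p)
  let f : P →ₐ[ZMod p] K := MvPolynomial.aeval fun y => y
  have hf : Function.Surjective f := fun y => ⟨MvPolynomial.X y, MvPolynomial.aeval_X _ y⟩
  let B := P ⧸ RingHom.ker f.toRingHom ^ 2
  let π : B →+* K := f.kerSquareLift.toRingHom
  have hπ : Function.Surjective π := fun y => by
    obtain ⟨x, rfl⟩ := hf y
    exact ⟨Ideal.Quotient.mk _ x, rfl⟩
  -- the kernel of `π` is the maximal ideal `J/J²`, of square zero
  haveI : (RingHom.ker π).IsMaximal := RingHom.ker_isMaximal_of_surjective π hπ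
  have hI2 : RingHom.ker π ^ 2 = ⊥ := by
    rw [show RingHom.ker π = (RingHom.ker f.toRingHom).cotangentIdeal from f.ker_kerSquareLift]
    exact Ideal.cotangentIdeal_square _
  -- `B` is nontrivial (it maps onto the field `K`) of characteristic `p`
  haveI : Nontrivial B := ⟨⟨0, 1, fun h => by simpa using congrArg π h⟩⟩
  haveI : CharP B p := by
    refine (CharP.charP_iff_prime_eq_zero Fact.out).mpr ?_
    have : (p : B) = algebraMap (ZMod p) B (p : ZMod p) := by rw [map_natCast]
    rw [this, ZMod.natCast_self, map_zero]
  -- Cohen's section of `B → B/(J/J²)`, transported along `B/(J/J²) ≅ K`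
  obtain ⟨σ', hσ'⟩ :=
    Literature.RingTheory.CompleteLocalRings.exists_ringHom_section_of_sq_eq_bot_of_charP
      (RingHom.ker π) p hI2
  let e : B ⧸ RingHom.ker π ≃+* K := RingHom.quotientKerEquivOfSurjective hπ
  let σ : K →+* B := σ'.comp e.symm.toRingHom
  have hσ : ∀ y, π (σ y) = y := fun y => by
    change e (Ideal.Quotient.mk (RingHom.ker π) (σ' (e.symm y))) = y
    rw [hσ', RingEquiv.apply_symm_apply]
  let g : K →ₐ[ZMod p] B :=
    { σ with
      commutes' := fun r => by
        have h := RingHom.ext_zmod (σ.comp (algebraMap (ZMod p) K)) (algebraMap (ZMod p) B)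
        simpa using RingHom.congr_fun h r }
  refine Algebra.FormallySmooth.of_split f g ?_
  ext y
  exact hσ y

/-- The same, with the canonical `ZMod p`-algebra structure of a field of characteristic `p`
(`ZMod.algebra`). [cite: Matsumura1987, Thm. 26.9 (case of the prime field)] -/
theorem formallySmooth_zmod_of_charP (K : Type u) [Field K] (p : ℕ) [Fact p.Prime] [CharP K p] :
    letI := ZMod.algebra K p
    Algebra.FormallySmooth (ZMod p) K :=
  letI := ZMod.algebra K p
  formallySmooth_zmod K p

end Literature.FieldTheory.Separability

end
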